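import Summits.HodgeConjecture.CorCM.Census.FermatTypesCyclotomic
import HarnessLib

/-!
# The decic CM subfield `K ⊂ ℚ(ζ₃₁)`: exactly ONE of its four isogeny classes of simple CM factors is a Fermat factor (levels `31`, `62`) — kernel census

COR-CM (cell `pub-hodgecm2`), count-neutral kernel census by the PORTFOLIO seat lit-andre-3 (gen 10, ask A6-R20, second half), sequel of
`Census/FermatTypesCyclotomic.lean` (same model `units / fermatType`, same dictionary [cite: KoblitzRohrlich1978, §1 pp. 1183–1184]) and
companion of `Census/DecicCyclicSpecies.lean` (type `ℤ/10`).  No named fact, no geometry, no `sorry`: `decide` only.  Cell note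
`HOME/pub-hodgecm2-lit-andre-3/PORTFOLIO-lit-andre-3-g10.md` §3.

SETTING.  `Gal(ℚ(ζ₃₁)/ℚ) = (ℤ/31)ˣ = ⟨3⟩` (cyclic of order `30`); `K := ℚ(ζ₃₁)^{⟨5⟩}` (`⟨5⟩ = {1, 5, 25}`, the subgroup of order `3`) is the
CYCLIC CM FIELD OF DEGREE `10` inside `ℚ(ζ₃₁)` (CM because `-1 ∉ ⟨5⟩`; its subfields are `ℚ(√-31)` and the real quintic field of conductor
`31`).  With the generator `σ = σ₃ : ζ ↦ ζ³` the embeddings `K → ℚ̄` are `σᵗ|_K`, `t ∈ ℤ/10`, complex conjugation `σ¹⁵ ↦ 5`: this is the model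
`(G, c) = (ℤ/10, 5)` of `Census/DecicCyclicSpecies.lean`, whose simple factors are `E` (CM by `ℚ(√-31)`, type `{0,2,4,6,8}`) and the
fivefolds `B₀, B₁, B₂` (types `{0,1,2,3,4}`, `{0,1,2,4,8}`, `{0,1,3,4,7}` up to translation).  A CM type `S ⊆ ℤ/10` of `K` INDUCES the CM type
`{3ʲ : j mod 10 ∈ S} ⊆ (ℤ/31)ˣ` of `ℚ(ζ₃₁)` (`inducedType`), and a CM type of `ℚ(ζ₃₁)` is induced from `K` iff it is stable under
multiplication by `5` (`stable5`) [folklore: `T` induced from `F^H` iff `T·H = T`].  The simple factor of `J(F_m)` indexed by `(a,b,c)`,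
`a + b + c ≡ 0 (m)`, has CM type `H_{a,b,c} = {t ∈ (ℤ/m)ˣ : ⟨ta⟩ + ⟨tb⟩ + ⟨tc⟩ = m}` read in `ℚ(ζ_M)`, `M = m / gcd(m,a,b,c)`, and it is
ISOGENOUS TO A POWER OF the simple CM abelian variety whose type (up to a unit translate `u·H_{a,b,c} = H_{a/u, b/u, c/u}`, the twist of the
action) is `H_{a,b,c}` restricted to the fixed field of its stabiliser [cite: KoblitzRohrlich1978, §1 pp. 1183–1184].  Hence: a simple factor
`X ∈ {E, B₀, B₁, B₂}` of the `K`-slice is an isogeny factor of `J(F_m)`, `31 ∣ m`, iff some unit translate of some `H_{a,b,c}` of level `m` with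
`ℚ(ζ_M) ⊇ K` is the type of `ℚ(ζ₃₁)` induced from (a translate of) the type of `X`.  AOKI LEVELS: the Hodge conjecture for all powers of
`J(F_m)` is in print for `m = pᵉ, 2pᵉ` [cite: Aoki2002CMFermatType, Thm 1.2 (i)] (tree record `Aoki2002_hodgeClasses_algebraic_fermatJacobianPowers`);
the levels with `K ⊆ ℚ(ζ_M) = ℚ(ζ₃₁)` are `M ∈ {31, 62}` (for `M = 31ᵉ, 2·31ᵉ`, `e ≥ 2`, a factor with CM field EQUAL to `K` would need a
stabiliser of order `3·31^{e-1}` in `(ℤ/M)ˣ`; not censused here — see the cell note §3 for Aoki's stabiliser theorem, which excludes it).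
NORMALISATION `a = 1`: every entry of a level-`31` triple is a unit, and a level-`62` triple with `M = 62` has a unit entry (if `a = 31`
then one of `b, c` is odd, and it is not `31` since `a + b + c ≡ 0`); as `u·H_{a,b,c} = H_{a/u,b/u,c/u}` and the set of `K`-induced types is
translation-stable, "some translate of `H_{a,b,c}` is `K`-induced" iff "`H_{1,b/a,c/a}` is `K`-induced" — so it suffices to test the
`29 + 60` types `H_{1,b,-1-b}` (`thirtyone_census`, `sixtytwo_census`).

RESULTS (kernel).  `thirtyone_census`: among `b ∈ ℤ/31 ∖ {0, -1}` exactly `b ∈ {5, 25}` give a `K`-induced type, and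
`H_{1,5,25} = inducedType {0,1,2,4,8}` — the type of `B₁` ON THE NOSE (`Census/DecicCyclicSpecies.blockType 2`), with stabiliser exactly
`{1,5,25}` (`stabiliser_one_five`), so the factor of `J(F₃₁)` indexed by `(1,5,25)` — the Jacobian of the quotient curve `v³¹ = u(1-u)⁵`, of
genus `15` — is isogenous to `B₁³`, `B₁` the simple CM fivefold with CM by `K` of the `Aut(ℤ/10)`-INVARIANT class (intrinsic: independent of
the choice of generator `σ`).  `sixtytwo_census`: NO `b ∈ ℤ/62 ∖ {0, -1}` gives a `K`-induced type (reduction `(ℤ/62)ˣ ≅ (ℤ/31)ˣ`).  So: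
`B₁` is a Fermat factor; `E` (CM by `ℚ(√-31)`), `B₀`, `B₂` are NOT factors of `J(F₃₁)` or `J(F₆₂)`.  CONSEQUENCE for the cell (informal, cell
note §3): Aoki/Shioda contributes to the `K`-slice only `HC(B₁ⁿ)`, which the tree already has unconditionally for all four factors
(b04, `CorCM/CyclicTimesPrimeCMTypesField.lean`: primitive types of cyclic order-`2q` fields are nondegenerate); none of the three atom
orbits of `Census/DecicCyclicSpecies.lean` (Weil plane of `E × B₀` — known by Markman — and the two codimension-`2` graph orbits on
`B₁ × B₀`, `B₂ × B₀`, or equivalently on `B₁ × B₀`, `B₁ × B₂`) lives on a product of Fermat factors: for `K ⊂ ℚ(ζ₃₁)` the slice's Hodge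
conjecture is OPEN beyond `ℤ⟨divisors⟩ +` Markman, and reduces to `GHC(B₀; 3, 1)` (two rank-`10` level-one pieces of `H³(B₀)`).  Contrast:
`ℚ(ζ₁₁)` (all `32` types Fermat at level `22`, `Census/FermatTypesCyclotomicLevel22.lean`) — there the whole slice is known.

## References
* [KoblitzRohrlich1978] N. Koblitz, D. Rohrlich, Simple factors in the Jacobian of a Fermat curve, Canad. J. Math. 30 (1978), §1 pp. 1183–1184.
* [Aoki2002CMFermatType] N. Aoki, Comment. Math. Univ. St. Pauli 51 (2002), Thm. 1.2.

## Provenance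
Exact oracle `scratch/fermat31.py` (seat folder; copy in `HOME/pub-hodgecm2-lit-andre-3/g10/`), `< 1 s`.
-/

namespace Summit.HodgeConjecture.CorCM.Census.DecicFermatCoverage31

open Finset
open Summit.HodgeConjecture.CorCM.Census.FermatTypesCyclotomic (units fermatType)

/-- The CM type of `ℚ(ζ₃₁)` induced from the CM type `S ⊆ ℤ/10` of `K = ℚ(ζ₃₁)^{⟨5⟩}` (embedding `σ₃ᵗ|_K ↔ t`): `{3ʲ : j < 30, j mod 10 ∈ S}`.
[folklore] -/
def inducedType (S : Finset (ZMod 10)) : Finset (ZMod 31) :=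
  ((range 30).filter fun j : ℕ => ((j : ZMod 10)) ∈ S).image fun j : ℕ => (3 : ZMod 31) ^ j

/-- Boolean test: a set of units of `ℤ/31` is stable under multiplication by `5`, i.e. (for a CM type) induced from `K`. [folklore] -/
def stable5 (T : Finset (ZMod 31)) : Bool := decide (T.image (fun t => 5 * t) = T)

/-- Reduction `(ℤ/62)ˣ → (ℤ/31)ˣ` of a set of residues (a bijection on units). [folklore] -/
def reduce31 (T : Finset (ZMod 62)) : Finset (ZMod 31) := T.image fun t => (t.val : ZMod 31)

set_option maxRecDepth 16000 in
set_option maxHeartbeats 8000000 in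
/-- **Level `31`.**  For `b ∈ ℤ/31` with `b ≠ 0`, `b ≠ -1` (so `(1, b, -1-b)` indexes a factor of `J(F₃₁)`), the Fermat type
`H_{1,b,-1-b}` is induced from `K` iff `b ∈ {5, 25}`; and `H_{1,5,25}` is the type induced from `{0,1,2,4,8}` (the block type of `B₁`).
[cite: KoblitzRohrlich1978, §1 pp. 1183–1184] -/
theorem thirtyone_census :
    (((univ : Finset (ZMod 31)).filter fun b => b ≠ 0 ∧ b ≠ -1 ∧ stable5 (fermatType 31 1 b) = true) = {5, 25}) ∧
    fermatType 31 1 5 = inducedType {0, 1, 2, 4, 8} ∧ fermatType 31 1 25 = fermatType 31 1 5 := by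
  refine ⟨by decide +kernel, by decide +kernel, by decide +kernel⟩

set_option maxRecDepth 16000 in
set_option maxHeartbeats 8000000 in
/-- The stabiliser of `H_{1,5,25}` in `(ℤ/31)ˣ` is exactly `⟨5⟩ = {1, 5, 25}`: the factor has CM field exactly `K` and a PRIMITIVE type
(dimension `[K:ℚ]/2 = 5`), so `J(v³¹ = u(1-u)⁵) ∼ B₁³`. [cite: KoblitzRohrlich1978, §1 p. 1184] -/
theorem stabiliser_one_five :
    ((units 31).filter fun u => (fermatType 31 1 5).image (fun t => u * t) = fermatType 31 1 5) = {1, 5, 25} ∧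
    (inducedType {0, 2, 4, 6, 8}).card = 15 ∧ stable5 (inducedType {0, 2, 4, 6, 8}) = true ∧
    stable5 (inducedType {0, 1, 2, 3, 4}) = true ∧ stable5 (inducedType {0, 1, 3, 4, 7}) = true := by
  refine ⟨by decide +kernel, by decide +kernel, by decide +kernel, by decide +kernel, by decide +kernel⟩

set_option maxRecDepth 16000 in
set_option maxHeartbeats 8000000 in
/-- **Level `62 = 2·31`.**  For NO `b ∈ ℤ/62` with `b ≠ 0`, `b ≠ -1` is the Fermat type `H_{1,b,-1-b}` of `J(F₆₂)` (read in
`(ℤ/31)ˣ ≅ (ℤ/62)ˣ`) induced from `K`: level `62` adds no factor of the `K`-slice. [cite: KoblitzRohrlich1978, §1 pp. 1183–1184] -/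
theorem sixtytwo_census :
    ((univ : Finset (ZMod 62)).filter fun b => b ≠ 0 ∧ b ≠ -1 ∧ stable5 (reduce31 (fermatType 62 1 b)) = true) = ∅ := by
  decide +kernel

end Summit.HodgeConjecture.CorCM.Census.DecicFermatCoverage31
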